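import Summits.KontsevichZagierPeriods.KontsevichZagierPeriods.Theses.SymplecticScissors
import Literature.NumberTheory.Transcendental.BakerLogarithmsConclusion

/-!
# Stub 4 of line `mordell-weil-normal-form` (`stub_toricIndependence`) from `baker_holds`

Refuter drefute by-product (positive lemma, evidence for the lead): Baker's theorem in real
clothes. If `bᵢ > 0` and `βₖ` are real algebraic numbers and the complex logarithms `log bᵢ`,
`i·arctan βₖ` are `ℚ`-linearly independent, then `1, log bᵢ, arctan βₖ` are linearly independent
over the real algebraic numbers.
-/

noncomputable section

open Complex

namespace Summit.KontsevichZagierPeriods.SymplecticScissors.MordellWeilRefuter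

/-- `exp (i · arctan β) = (1 + iβ)/√(1+β²)` is algebraic for real algebraic `β`. [folklore] -/
theorem isAlgebraic_exp_I_mul_arctan {β : ℝ} (hβ : IsAlgebraic ℚ β) :
    IsAlgebraic ℚ (Complex.exp (Complex.I * ((Real.arctan β : ℝ) : ℂ))) := by
  have hsq : IsAlgebraic ℚ (Real.sqrt (1 + β ^ 2)) := by
    have h1 : IsAlgebraic ℚ (1 + β ^ 2) := isAlgebraic_one.add (hβ.pow 2)
    refine IsAlgebraic.of_pow (n := 2) (by norm_num) ?_
    rw [Real.sq_sqrt (by positivity)]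
    exact h1
  have hcos : IsAlgebraic ℚ (Real.cos (Real.arctan β)) := by
    rw [Real.cos_arctan, one_div]
    exact hsq.inv
  have hsin : IsAlgebraic ℚ (Real.sin (Real.arctan β)) := by
    rw [Real.sin_arctan, div_eq_mul_inv]
    exact hβ.mul hsq.inv
  have hI : IsAlgebraic ℚ Complex.I := by
    refine ⟨Polynomial.X ^ 2 + 1, Polynomial.Monic.ne_zero (by monicity!), ?_⟩
    simp
  rw [mul_comm, Complex.exp_mul_I, ← Complex.ofReal_cos, ← Complex.ofReal_sin]
  exact hcos.algebraMap.add (hsin.algebraMap.mul hI)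

/-- `exp (log b) = b` is algebraic for real algebraic `b > 0`. [folklore] -/
theorem isAlgebraic_exp_log {b : ℝ} (hb : IsAlgebraic ℚ b) (hb0 : 0 < b) :
    IsAlgebraic ℚ (Complex.exp ((Real.log b : ℝ) : ℂ)) := by
  rw [← Complex.ofReal_exp, Real.exp_log hb0]
  exact hb.algebraMap

/-- **Stub 4 (`stub_toricIndependence`) proved from `baker_holds`.** [cite: Baker1975, Theorem 2.1] -/
theorem stub_toricIndependence_holds :
    ∀ (p q : ℕ) (b : Fin p → ℝ) (β : Fin q → ℝ), (∀ i, IsAlgebraic ℚ (b i)) → (∀ i, 0 < b i) →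
      (∀ i, IsAlgebraic ℚ (β i)) →
      LinearIndependent ℚ (Sum.elim (fun i => ((Real.log (b i) : ℝ) : ℂ))
        (fun i => Complex.I * ((Real.arctan (β i) : ℝ) : ℂ)) : Fin p ⊕ Fin q → ℂ) →
      ∀ μ : Unit ⊕ (Fin p ⊕ Fin q) → ℝ, (∀ j, IsAlgebraic ℚ (μ j)) →
        ∑ j, μ j * Sum.elim (fun _ => (1 : ℝ))
          (Sum.elim (fun i => Real.log (b i)) (fun i => Real.arctan (β i))) j = 0 →
        ∀ j, μ j = 0 := by
  intro p q b β hb hbpos hβ hli μ hμ hsum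
  classical
  set l : Fin p ⊕ Fin q → ℂ := Sum.elim (fun i => ((Real.log (b i) : ℝ) : ℂ))
    (fun i => Complex.I * ((Real.arctan (β i) : ℝ) : ℂ)) with hl
  have halg : ∀ i, IsAlgebraic ℚ (Complex.exp (l i)) := by
    rintro (i | i)
    · simpa [hl] using isAlgebraic_exp_log (hb i) (hbpos i)
    · simpa [hl] using isAlgebraic_exp_I_mul_arctan (hβ i)
  have hB := Literature.NumberTheory.Transcendental.baker_holds l halg hli
  -- complex algebraic coefficients: `μ₀`, `μᵢ`, `-i μₖ`
  have hI : IsAlgebraic ℚ Complex.I := by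
    refine ⟨Polynomial.X ^ 2 + 1, Polynomial.Monic.ne_zero (by monicity!), ?_⟩
    simp
  let cfun : Option (Fin p ⊕ Fin q) → ℂ := fun o =>
    o.elim ((μ (Sum.inl ())) : ℂ)
      (Sum.elim (fun i => ((μ (Sum.inr (Sum.inl i)) : ℝ) : ℂ))
        (fun k => -Complex.I * ((μ (Sum.inr (Sum.inr k)) : ℝ) : ℂ)))
  have hcalg : ∀ o, IsAlgebraic ℚ (cfun o) := by
    rintro (_ | (i | k))
    · exact (hμ _).algebraMap
    · exact (hμ _).algebraMap
    · exact hI.neg.mul (hμ _).algebraMap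
  let g : Option (Fin p ⊕ Fin q) → algebraicClosure ℚ ℂ := fun o =>
    ⟨cfun o, mem_algebraicClosure_iff.mpr (hcalg o)⟩
  -- the relation in `ℂ`
  have hrel : ∑ o, g o • (o.elim (1 : ℂ) l) = 0 := by
    simp only [IntermediateField.smul_def, smul_eq_mul]
    rw [Fintype.sum_option]
    simp only [Option.elim_none, Option.elim_some, mul_one]
    rw [Fintype.sum_sum_type]
    have hsumC : ((∑ j, μ j * Sum.elim (fun _ => (1 : ℝ))
        (Sum.elim (fun i => Real.log (b i)) (fun i => Real.arctan (β i))) j : ℝ) : ℂ) = 0 := by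
      rw [hsum]; simp
    rw [Fintype.sum_sum_type, Fintype.sum_sum_type] at hsumC
    push_cast at hsumC
    simp only [Finset.univ_unique, Finset.sum_singleton, Sum.elim_inl, Sum.elim_inr] at hsumC
    have key : ∀ k : Fin q, -Complex.I * ((μ (Sum.inr (Sum.inr k)) : ℝ) : ℂ) *
        (Complex.I * ((Real.arctan (β k) : ℝ) : ℂ)) =
        ((μ (Sum.inr (Sum.inr k)) : ℝ) : ℂ) * ((Real.arctan (β k) : ℝ) : ℂ) := by
      intro k
      have : Complex.I * Complex.I = -1 := Complex.I_mul_I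
      linear_combination (-((μ (Sum.inr (Sum.inr k)) : ℝ) : ℂ) * ((Real.arctan (β k) : ℝ) : ℂ)) * this
    simp only [g, cfun, hl, Option.elim_none, Option.elim_some, Sum.elim_inl, Sum.elim_inr, key]
    rw [← hsumC]
    simp
  have h0 := Fintype.linearIndependent_iff.mp hB g hrel
  have hg : ∀ o, cfun o = 0 := fun o => by
    have := congrArg (fun x : algebraicClosure ℚ ℂ => (x : ℂ)) (h0 o)
    simpa [g] using this
  rintro (u | (i | k))
  · have := hg none
    simp only [cfun, Option.elim_none] at this
    cases u; exact_mod_cast this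
  · have := hg (some (Sum.inl i))
    simp only [cfun, Option.elim_some, Sum.elim_inl] at this
    exact_mod_cast this
  · have := hg (some (Sum.inr k))
    simp only [cfun, Option.elim_some, Sum.elim_inr, neg_mul, neg_eq_zero, mul_eq_zero,
      Complex.I_ne_zero, false_or] at this
    exact_mod_cast this

end Summit.KontsevichZagierPeriods.SymplecticScissors.MordellWeilRefuter

end
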